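import Literature.Probability.LatticeModels.HighDimPointwiseTriviality
import HarnessLib

/-!
# Inward quasi-monotonicity of the two-point function of a pointwise scaling limit (MMS in the limit)

Topic `Probability/LatticeModels`; family `crit-ising`. THEOREM-ONLY leaf file (no definitions, no
named facts). For the critical correlators `criticalCorr d` of the nearest-neighbour Ising model on
`ℤ^d` and ANY pointwise scaling limit `S` (`HasPointwiseScalingLimit (criticalCorr d) ρ S`, any
renormalisation `ρ`, `d ≥ 1`):

* `HasPointwiseScalingLimit.two_le_two_of_mul_norm_lt` — `S₂(x') ≤ S₂(x)` for non-coincident pairs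
  with `d·‖x₀ - x₁‖_∞ < ‖x'₀ - x'₁‖_∞` (sup norms of `ℝ^d`): the Messager–Miracle-Solé comparison
  `‖w‖_∞ ≥ d‖v‖_∞ ⇒ ⟨σ₀σ_w⟩ ≤ ⟨σ₀σ_v⟩` (tree theorem `twoPointPlus_le_of_mul_supNorm_le`) passed to
  the limit through the floor geometry of `[·/δ]` (`supNorm_latticeApprox_sub_le`,
  `le_supNorm_latticeApprox_sub`).
* `HasPointwiseScalingLimit.two_pos_of_mul_norm_lt` — hence positivity of `S₂` at one pair
  propagates to all `d`-fold nearer pairs.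

This is the rigorous part of "the limiting two-point function is radially decreasing"; the outward
comparison (doubling) is open on `ℤ³`.

## References

* A. Messager, S. Miracle-Solé, J. Stat. Phys. 17 (1977) 245–262, Theorem (monotonicity of
  correlations) [MessagerMiracleSoleJSP1977].
-/

noncomputable section

open Filter Topology

namespace Literature.Probability.LatticeModels

variable {d : ℕ}

/-- Real sup-norm bound on a lattice difference of approximations from above:
`‖[p/δ] - [q/δ]‖_∞ ≤ ‖p - q‖_∞/δ + 2`. [folklore] -/
theorem supNorm_latticeApprox_sub_le {δ : ℝ} (hδ : 0 < δ) (p q : EuclideanSpace ℝ (Fin d)) :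
    (Site.supNorm (latticeApprox δ p - latticeApprox δ q) : ℝ) ≤
      ‖WithLp.ofLp p - WithLp.ofLp q‖ / δ + 2 := by
  rw [← Site.norm_eq_supNorm, pi_norm_le_iff_of_nonneg (by positivity)]
  intro k
  rw [Pi.sub_apply, Int.norm_eq_abs]
  have h := abs_mul_sub_latticeApprox_sub_le hδ p q k
  have hk : |p k - q k| ≤ ‖WithLp.ofLp p - WithLp.ofLp q‖ := by
    have := norm_le_pi_norm (WithLp.ofLp p - WithLp.ofLp q) k
    rwa [Pi.sub_apply, Real.norm_eq_abs] at this
  have h1 : δ * |((latticeApprox δ p k : ℝ) - (latticeApprox δ q k : ℝ))| ≤ |p k - q k| + 2 * δ := by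
    have := abs_sub_abs_le_abs_sub (δ * ((latticeApprox δ p k : ℝ) - (latticeApprox δ q k : ℝ))) (p k - q k)
    rw [abs_mul, abs_of_pos hδ] at this
    linarith
  push_cast
  rw [div_add' _ _ _ hδ.ne', le_div_iff₀ hδ]
  linarith

/-- … and from below (`d ≥ 1`): `‖p - q‖_∞/δ - 2 ≤ ‖[p/δ] - [q/δ]‖_∞`. [folklore] -/
theorem le_supNorm_latticeApprox_sub (hd : 1 ≤ d) {δ : ℝ} (hδ : 0 < δ) (p q : EuclideanSpace ℝ (Fin d)) :
    ‖WithLp.ofLp p - WithLp.ofLp q‖ / δ - 2 ≤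
      (Site.supNorm (latticeApprox δ p - latticeApprox δ q) : ℝ) := by
  -- the coordinate achieving the sup norm of `p - q`
  have hne : (Finset.univ : Finset (Fin d)).Nonempty := ⟨⟨0, hd⟩, Finset.mem_univ _⟩
  obtain ⟨k, -, hk⟩ := Finset.exists_mem_eq_sup Finset.univ hne fun i => ‖(WithLp.ofLp p - WithLp.ofLp q) i‖₊
  have hnorm : ‖WithLp.ofLp p - WithLp.ofLp q‖ = |p k - q k| := by
    rw [Pi.norm_def, hk]
    simp [Pi.sub_apply]
  have h := abs_mul_sub_latticeApprox_sub_le hδ p q k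
  have hco : |((latticeApprox δ p - latticeApprox δ q) k : ℝ)| ≤
      (Site.supNorm (latticeApprox δ p - latticeApprox δ q) : ℝ) := abs_coord_le_supNorm _ k
  have hcast : (((latticeApprox δ p - latticeApprox δ q) k : ℤ) : ℝ) =
      (latticeApprox δ p k : ℝ) - (latticeApprox δ q k : ℝ) := by push_cast [Pi.sub_apply]; ring
  rw [hcast] at hco
  have h2 : |p k - q k| - 2 * δ ≤ δ * |(latticeApprox δ p k : ℝ) - (latticeApprox δ q k : ℝ)| := by
    have t : |p k - q k| ≤ |δ * ((latticeApprox δ p k : ℝ) - (latticeApprox δ q k : ℝ))| +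
        |δ * ((latticeApprox δ p k : ℝ) - (latticeApprox δ q k : ℝ)) - (p k - q k)| := by
      calc |p k - q k| = |δ * ((latticeApprox δ p k : ℝ) - (latticeApprox δ q k : ℝ)) -
            (δ * ((latticeApprox δ p k : ℝ) - (latticeApprox δ q k : ℝ)) - (p k - q k))| := by ring_nf
        _ ≤ _ := abs_sub _ _
    rw [abs_mul, abs_of_pos hδ] at t
    linarith
  have h3 : δ * |(latticeApprox δ p k : ℝ) - (latticeApprox δ q k : ℝ)| ≤
      δ * (Site.supNorm (latticeApprox δ p - latticeApprox δ q) : ℝ) := mul_le_mul_of_nonneg_left hco hδ.le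
  rw [hnorm, sub_le_iff_le_add, div_le_iff₀ hδ]
  linarith

/-- **Inward quasi-monotonicity of the limiting two-point function** (what the Messager–Miracle-Solé
comparison `twoPointPlus_le_of_mul_supNorm_le` gives in the limit): for every pointwise scaling limit
`S` of `criticalCorr d` (any `ρ`, `d ≥ 1`) and non-coincident pairs `x`, `x'` with
`d·‖x₀ - x₁‖_∞ < ‖x'₀ - x'₁‖_∞` (sup norms), `S₂(x') ≤ S₂(x)`: the two-point function of a
candidate limit cannot INCREASE outward by more than the factor-`d` dilation. Positivity of `S₂` at
a far pair thus propagates to all `d`-fold nearer pairs; the converse propagation (outward) is the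
open two-point doubling problem on `ℤ³`. [cite: MessagerMiracleSoleJSP1977, Theorem (monotonicity)] -/
theorem HasPointwiseScalingLimit.two_le_two_of_mul_norm_lt (hd : 1 ≤ d) {ρ : ℝ → ℝ} {S : CorrFamily d}
    (hlim : HasPointwiseScalingLimit (criticalCorr d) ρ S)
    {x x' : Fin 2 → EuclideanSpace ℝ (Fin d)} (hx : x ∈ NonCoincident d 2) (hx' : x' ∈ NonCoincident d 2)
    (hfar : (d : ℝ) * ‖WithLp.ofLp (x 0) - WithLp.ofLp (x 1)‖ < ‖WithLp.ofLp (x' 0) - WithLp.ofLp (x' 1)‖) :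
    S 2 x' ≤ S 2 x := by
  have hβ : 0 ≤ criticalBeta d := criticalBeta_nonneg d
  -- the two rescaled pair correlators
  have hT : ∀ {z : Fin 2 → EuclideanSpace ℝ (Fin d)}, z ∈ NonCoincident d 2 →
      Tendsto (fun δ => ρ δ ^ 2 * criticalTwoPoint d (latticeApprox δ (z 1) - latticeApprox δ (z 0)))
        (𝓝[>] 0) (𝓝 (S 2 z)) := by
    intro z hz
    refine Tendsto.congr (fun δ => ?_) ((hlim 2).tendsto_at hz)
    rw [rescaledCorrelator_apply, latticeApprox_comp_two, criticalCorr_two_pair]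
  -- eventually the lattice comparison holds
  set A : ℝ := ‖WithLp.ofLp (x 0) - WithLp.ofLp (x 1)‖ with hA
  set B : ℝ := ‖WithLp.ofLp (x' 0) - WithLp.ofLp (x' 1)‖ with hB
  have hgap : 0 < B - d * A := by linarith
  have hev : ∀ᶠ δ in 𝓝[>] (0:ℝ), ρ δ ^ 2 * criticalTwoPoint d (latticeApprox δ (x' 1) - latticeApprox δ (x' 0))
      ≤ ρ δ ^ 2 * criticalTwoPoint d (latticeApprox δ (x 1) - latticeApprox δ (x 0)) := by
    have hm : Set.Ioo (0:ℝ) ((B - d * A) / (2 * d + 2)) ∈ 𝓝[>] (0:ℝ) := Ioo_mem_nhdsGT (by positivity)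
    filter_upwards [hm] with δ hδ
    refine mul_le_mul_of_nonneg_left ?_ (sq_nonneg _)
    refine twoPointPlus_le_of_mul_supNorm_le hβ ?_
    -- `d * ‖[x1/δ]-[x0/δ]‖_∞ ≤ ‖[x'1/δ]-[x'0/δ]‖_∞`
    have h1 := supNorm_latticeApprox_sub_le hδ.1 (x 1) (x 0)
    have h2 := le_supNorm_latticeApprox_sub hd hδ.1 (x' 1) (x' 0)
    have hA' : ‖WithLp.ofLp (x 1) - WithLp.ofLp (x 0)‖ = A := by rw [hA, norm_sub_rev]
    have hB' : ‖WithLp.ofLp (x' 1) - WithLp.ofLp (x' 0)‖ = B := by rw [hB, norm_sub_rev]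
    rw [hA'] at h1; rw [hB'] at h2
    have hd0 : (0:ℝ) ≤ d := by positivity
    have hδlt : δ * (2 * d + 2) < B - d * A := by
      have := hδ.2; rwa [lt_div_iff₀ (by positivity)] at this
    have key : (d : ℝ) * (Site.supNorm (latticeApprox δ (x 1) - latticeApprox δ (x 0)) : ℝ) ≤
        (Site.supNorm (latticeApprox δ (x' 1) - latticeApprox δ (x' 0)) : ℝ) := by
      have e1 : (d : ℝ) * (Site.supNorm (latticeApprox δ (x 1) - latticeApprox δ (x 0)) : ℝ) ≤ d * (A / δ + 2) :=
        mul_le_mul_of_nonneg_left h1 hd0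
      have e2 : (d : ℝ) * (A / δ + 2) ≤ B / δ - 2 := by
        have hδ0 : δ ≠ 0 := hδ.1.ne'
        have key : (B / δ - 2) - (d : ℝ) * (A / δ + 2) = (B - d * A - δ * (2 * d + 2)) / δ := by
          field_simp
          ring
        have hnn : 0 ≤ (B - d * A - δ * (2 * d + 2)) / δ := div_nonneg (by linarith) hδ.1.le
        linarith [key]
      linarith
    exact_mod_cast key
  exact le_of_tendsto_of_tendsto (hT hx') (hT hx) hev

/-- **Positivity propagates inward**: if a pointwise limit has `S₂(x') > 0` at one pair, then
`S₂(x) > 0` at every pair with `d·‖x₀-x₁‖_∞ < ‖x'₀-x'₁‖_∞`. (Outward propagation would need a doubling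
lower bound for `⟨σ₀σ_x⟩_{β_c}`, which is not in print for `ℤ³`.) [cite: MessagerMiracleSoleJSP1977, Theorem (monotonicity)] -/
theorem HasPointwiseScalingLimit.two_pos_of_mul_norm_lt (hd : 1 ≤ d) {ρ : ℝ → ℝ} {S : CorrFamily d}
    (hlim : HasPointwiseScalingLimit (criticalCorr d) ρ S)
    {x x' : Fin 2 → EuclideanSpace ℝ (Fin d)} (hx : x ∈ NonCoincident d 2) (hx' : x' ∈ NonCoincident d 2)
    (hfar : (d : ℝ) * ‖WithLp.ofLp (x 0) - WithLp.ofLp (x 1)‖ < ‖WithLp.ofLp (x' 0) - WithLp.ofLp (x' 1)‖)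
    (hpos : 0 < S 2 x') : 0 < S 2 x :=
  hpos.trans_le (hlim.two_le_two_of_mul_norm_lt hd hx hx' hfar)

end Literature.Probability.LatticeModels

end
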